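import Literature.Probability.Percolation.OneArmArcHulls
import Literature.Probability.Percolation.ArmEventsInterface
import Literature.Probability.Percolation.HalfPlaneTwoArmRadii
import Literature.Probability.Percolation.OneArmBoundaryArms
import HarnessLib

/-!
# The tail estimate (2.14) of Lawler–Schramm–Werner for the discrete arc hulls, with two arms (proofs only)

Topic `Literature/Probability/Percolation`; family `crit-perc`. Def-free, fact-free sequel of
`OneArmArcHulls.lean` (the discrete arc hulls `Q_δ(θ) = lswArcCompact R θ ω`, `δ = 1/R`, anchored
at the bottom point `-i`, and the joint laws `lswPairLaw R θ` of `(Q_δ(θ), Q_δ(2π))`).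
Lawler–Schramm–Werner, *One-arm exponent for critical 2D percolation*, Electron. J. Probab. **7**
(2002), paper no. 2, proof of Lemma 2.3 (p. 6): with `θ = 2π - ε` and `Z(r, ε)` "the event that
there is a connected component of `𝔅_δ ∩ 𝕌` which does not intersect `A_θ` but does intersect the
two circles of radii `ε` and `r` about the point `1`",

> (2.13) `P[Z(r, ε)] ≤ c (ε/r)^{1+α}` […] Let `Q' := Q(2π) ∖ Q(θ)`. By letting `δ ↓ 0`, it follows
> from (2.13) that (2.14) `P[diam Q' ≥ r] ≤ c (ε/r)^{1+α}`.

This file proves the discrete form of (2.14) for the tree's hulls with the exponent `1` of the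
half-plane TWO-arm event in place of `1 + α` (which suffices downstream thanks to the linear
conformal-radius deficit, `OneArmNeumannCouplingLinear.lean`): there is `c` such that for every
`θ < 2π` and `r > 0`, eventually as `R → ∞`,
`P[Q_δ(2π) ⊄ Q_δ(θ) ∪ B̄(-i, r)] ≤ c (2π - θ)/r` (`lswPairLaw_real_not_subset_eventually_le`).

The argument (LSW's "component which does not intersect `A_θ`", made into two arms):

* `relabel_mem_domArmEvent_of_cluster` — **two boundary arms of a cluster of the disc.** Let `C`
  be the set of sites joined to `x` by open sites inside the disc `D = {‖·‖ ≤ R}`, and suppose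
  every open site outside `D` adjacent to `C` (an "exit" of `C`) lies in the hexagonal ball of
  radius `m` about a site `c`, while `x` is at Euclidean distance `> n ≥ m` from `c`, and the sites
  within one lattice spacing of `D` lie in the half-plane `c + upperHalfPlane`. Then, seen from `c`,
  the configuration has an open and a closed arm from `∂Λ_m` to `∂Λ_n` inside the upper
  half-plane (`domArmEvent ![true, false] m n upperHalfPlane` after translation by `-c`). The open
  arm is a piece of `C`. The closed arm is a piece of the chain of right sites of the interface
  loop of the finite configuration `C` through the dart `a → b` of an exit edge
  (`exists_isSiteInterfaceLoop_of_adj`): the interface polygon winds once about `a` and not about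
  `b` (`loopWind_leftPt_sub_loopWind_rightPt`; `b` escapes to infinity along a horizontal lattice
  ray outside the disc, `exists_adj_ray`), the winding number is `1` on all of `C`
  (`loopWind_eq_of_pathIn`) and `0` at the outward neighbour `y*` of a site `x*` of `C` farthest
  from `c` (another ray), so the loop crosses the edge `x* y*` (`loopWind_triMeshPoint_eq_of_adj`),
  and its right sites from `b` to `y*` form a chain of sites outside `C` adjacent to `C`
  (`rv_succ_eq_or_adj`) — closed in `ω` wherever they are at hexagonal distance `≥ m` from `c`
  (an open one would be in `C` if inside the disc, an exit if outside). Both chains are trimmed to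
  arms by `PathIn.exists_arm_of_triNorm_le` and fed to `mem_domArmEvent_of_pathIn`.
* `exists_lsw_centre` — a site `c` on the axis below the disc, within `7/2` of `-iR`, such that
  all sites of norm `≤ R + 1` lie in `c + upperHalfPlane` (the tangent at `-i` is the lattice
  direction `e₀`).
* `relabel_mem_domArmEvent_of_not_subset` — **the hull event gives the two arms**: if
  `Q_δ(2π) ⊄ Q_δ(θ) ∪ B̄(-i, r)` (`2π - θ ≤ r`), the bad point is a rescaled site `x/R` of a
  cluster of the disc all of whose exits point in non-arc directions, hence lie within
  `(2π - θ)(R + 1) + 9/2` of `c` (`norm_sub_norm_mul_neg_I_le_of_not_inBottomArcDir`), while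
  `‖x - c‖ > rR - 7/2`.
* `lswPairLaw_real_not_subset_le` — hence `P[Q_δ(2π) ⊄ Q_δ(θ) ∪ B̄(-i, r)] ≤ C m/n` by translation
  invariance (`sitePercolation_real_preimage_relabel`) and the half-plane two-arm bound
  `Nolin2008_halfPlane_twoArm_holds` (Nolin 2008, Thm. 24 (i); LSW's Lemma A.1);
* `lswPairLaw_real_not_subset_eventually_le` — and the choice `m ≍ (2π - θ) R`, `n ≍ r R` gives
  the tail `≤ c (2π - θ)/r` eventually in `R`, for all `θ < 2π`, `r > 0`.

No new definitions, no named facts.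

## References

* G. F. Lawler, O. Schramm, W. Werner, *One-arm exponent for critical 2D percolation*, Electron.
  J. Probab. 7 (2002), no. 2, §2: proof of Lemma 2.3, (2.13)–(2.14) (p. 6); Appendix A, Lemma A.1
  (p. 10) [LawlerSchrammWernerEJP2002].
* P. Nolin, *Near-critical percolation in two dimensions*, Electron. J. Probab. 13 (2008), Thm. 24 (i)
  [Nolin2008].
* F. Camia, C. M. Newman, Comm. Math. Phys. 268 (2006), §4 (cluster interfaces as loops)
  [CamiaNewman2006].

## Mathlib / tree

Tree: `exists_isSiteInterfaceLoop_of_adj` (`SiteInterfaceStructure`), `IsSiteInterfaceLoop.lv/rv`,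
`loopWind_leftPt_sub_loopWind_rightPt`, `loopWind_triMeshPoint_eq_of_adj`, `rv_succ_eq_or_adj`
(`SiteInterfaceWinding`, `InterfaceLoopPolygon`), `loopWind_eq_of_pathIn(_compl)`,
`loopWind_triMeshPoint_eq_zero_of_lt_norm`, `exists_polyTrace_subset_closedBall`
(`ArmEventsInterface`), `eq_of_triEdgeFaces_eq` (`MacroscopicInterfaceLoop`),
`PathIn.exists_arm_of_triNorm_le` (`ArmSeparationGlue`), `mem_domArmEvent_of_pathIn`, `upperHalfPlane`,
`Nolin2008_halfPlane_twoArm_holds` (`HalfPlaneArmEvents`, `HalfPlaneTwoArmRadii`), `pathIn_ray`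
(`OneArmBoundaryArms`), `pathIn_map_iso`, `triShiftIso`, `sitePercolation_real_preimage_relabel`,
`norm_triEmbed_le_triNorm`, `mul_triNorm_le_norm_triEmbed`, `lswArcPair`, `lswPairLaw_apply`
(`OneArmArcHulls`). Mathlib: `Set.exists_max_image`, `Complex.abs_im_le_norm`, `Nat.floor_le`,
`Nat.lt_floor_add_one`, `Nat.le_ceil`, `Nat.ceil_lt_add_one`.
-/

noncomputable section

open MeasureTheory Filter Topology Set Metric TopologicalSpace Complex
open Literature.Probability.LatticeModels

namespace Literature.Probability.Percolation

/-! ### Outward lattice rays -/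

/-- The embedding is `ℤ`-linear: `triEmbed (n • x) = n · triEmbed x`. [folklore] -/
theorem triEmbed_zsmul (n : ℤ) (x : Site 2) : triEmbed (n • x) = (n : ℂ) * triEmbed x := by
  simp only [triEmbed, Pi.smul_apply, smul_eq_mul, Int.cast_mul]
  ring

/-- **An outward lattice direction.** From every site `z` and for every base point `P` there is a
lattice direction `u ∈ {±e₀}` (the one making a non-obtuse angle with `z - P`) along which the
squared distance to `P` grows at least like `j²`: `‖z - P‖² + j² ≤ ‖(z + j u) - P‖²`. [folklore] -/
theorem exists_adj_norm_sub_sq_le (z : Site 2) (P : ℂ) :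
    ∃ u : Site 2, triGraph.Adj 0 u ∧ ∀ j : ℕ,
      ‖triEmbed z - P‖ ^ 2 + (j : ℝ) ^ 2 ≤ ‖triEmbed (z + (j : ℤ) • u) - P‖ ^ 2 := by
  have h10 : (1 : Fin 2) ≠ 0 := by decide
  set w : ℂ := triEmbed z - P with hw
  have key : ∀ s : ℝ, s * s = 1 → 0 ≤ s * w.re → ∀ j : ℕ,
      ‖w‖ ^ 2 + (j : ℝ) ^ 2 ≤ ‖w + (s : ℂ) * (j : ℂ)‖ ^ 2 := by
    intro s hs hsw j
    rw [Complex.sq_norm, Complex.sq_norm, Complex.normSq_apply, Complex.normSq_apply]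
    simp only [Complex.add_re, Complex.add_im, Complex.mul_re, Complex.mul_im, Complex.ofReal_re,
      Complex.ofReal_im, Complex.natCast_re, Complex.natCast_im, mul_zero, zero_mul, sub_zero, add_zero]
    nlinarith [mul_nonneg (Nat.cast_nonneg j : (0 : ℝ) ≤ j) hsw]
  by_cases hre : 0 ≤ w.re
  · refine ⟨Pi.single 0 1, by rw [triGraph_adj_iff_coord]; simp [h10], fun j ↦ ?_⟩
    have : triEmbed (z + (j : ℤ) • (Pi.single 0 1 : Site 2)) - P = w + ((1 : ℝ) : ℂ) * (j : ℂ) := by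
      rw [triEmbed_add, triEmbed_zsmul, triEmbed_single_zero, hw]; push_cast; ring
    rw [this]
    exact key 1 (by norm_num) (by simpa using hre) j
  · push Not at hre
    refine ⟨-Pi.single 0 1, by rw [triGraph_adj_iff_coord]; simp [h10], fun j ↦ ?_⟩
    have : triEmbed (z + (j : ℤ) • (-Pi.single 0 1 : Site 2)) - P = w + ((-1 : ℝ) : ℂ) * (j : ℂ) := by
      rw [triEmbed_add, triEmbed_zsmul, triEmbed_neg, triEmbed_single_zero, hw]; push_cast; ring
    rw [this]
    exact key (-1) (by norm_num) (by nlinarith) j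

/-- **Outward rays.** From every site `z` and for every base point `P` there is a lattice direction
`u` such that along the ray `z + j u` the distance to `P` (i) never drops below `‖z - P‖`, (ii) is at
least `j`, and (iii) exceeds `‖z - P‖` strictly for `j ≥ 1`. [folklore] -/
theorem exists_adj_ray (z : Site 2) (P : ℂ) :
    ∃ u : Site 2, triGraph.Adj 0 u ∧
      (∀ j : ℕ, ‖triEmbed z - P‖ ≤ ‖triEmbed (z + (j : ℤ) • u) - P‖) ∧
      (∀ j : ℕ, (j : ℝ) ≤ ‖triEmbed (z + (j : ℤ) • u) - P‖) ∧
      (∀ j : ℕ, 1 ≤ j → ‖triEmbed z - P‖ < ‖triEmbed (z + (j : ℤ) • u) - P‖) := by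
  obtain ⟨u, hu, h⟩ := exists_adj_norm_sub_sq_le z P
  refine ⟨u, hu, fun j ↦ ?_, fun j ↦ ?_, fun j hj ↦ ?_⟩
  · exact (pow_le_pow_iff_left₀ (norm_nonneg _) (norm_nonneg _) two_ne_zero).1
      (le_trans (by nlinarith) (h j))
  · exact (pow_le_pow_iff_left₀ (Nat.cast_nonneg j) (norm_nonneg _) two_ne_zero).1
      (le_trans (by nlinarith [norm_nonneg (triEmbed z - P)]) (h j))
  · have hj1 : (1 : ℝ) ≤ j := by exact_mod_cast hj
    exact lt_of_pow_lt_pow_left₀ 2 (norm_nonneg _) (lt_of_lt_of_le (by nlinarith) (h j))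

/-- Translating an edge: `x ∼ y` iff `x - c ∼ y - c`. [folklore] -/
theorem triGraph_adj_sub_iff (c x y : Site 2) : triGraph.Adj (x - c) (y - c) ↔ triGraph.Adj x y := by
  have := triGraph_adj_shift_iff (-c) x y
  simpa [sub_eq_add_neg] using this

/-! ### Two boundary arms of a cluster of the disc -/

/-- **Two boundary arms of a cluster of the disc** (the deterministic heart of LSW's (2.13) ⇒
(2.14), with two arms). Let `D = {‖·‖ ≤ R}`, let `x ∼⋯∼ a` be open sites of `D` and `a ∼ b` with
`‖b‖ > R`; let `C` be the set of sites joined to `x` by open sites of `D`. Assume: every open site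
`b'` outside `D` adjacent to `C` has `|b' - c|_𝕋 < m` (all exits of the cluster are near `c`), and
so has `b`; `‖x - c‖ > n ≥ m`; and every site of norm `≤ R + 1` lies in the half-plane
`{v | c₁ ≤ v₁}`. Then the configuration translated by `-c` has an open and a closed arm from `∂Λ_m`
to `∂Λ_n` confined to the upper half-plane: the open one inside `C`, the closed one along the right
side of the interface loop of `C` through the dart `a → b`, which by the winding-number jump runs
from `b` to the outward neighbour of a farthest site of `C`.
[cite: LawlerSchrammWernerEJP2002, proof of Lemma 2.3, (2.13)–(2.14) (p. 6)] [cite: CamiaNewman2006, §4] -/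
theorem relabel_mem_domArmEvent_of_cluster {R : ℝ} {ω : SiteConfig (Site 2)} {x a b c : Site 2} {m n : ℕ}
    (hxa : PathIn triGraph ({v : Site 2 | ‖triEmbed v‖ ≤ R} ∩ ω) x a) (hab : triGraph.Adj a b)
    (hbR : R < ‖triEmbed b‖)
    (hexit : ∀ a' b' : Site 2, PathIn triGraph ({v : Site 2 | ‖triEmbed v‖ ≤ R} ∩ ω) x a' →
      triGraph.Adj a' b' → b' ∈ ω → R < ‖triEmbed b'‖ → triNorm (b' - c) < m)
    (hbm : triNorm (b - c) < m) (hx : (n : ℝ) < ‖triEmbed x - triEmbed c‖) (hmn : m ≤ n)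
    (hH : ∀ v : Site 2, ‖triEmbed v‖ ≤ R + 1 → c 1 ≤ v 1) :
    SiteConfig.relabel (triShiftIso (-c)).toEquiv ω ∈ domArmEvent ![true, false] m n upperHalfPlane := by
  classical
  -- the cluster of `x` inside the disc
  set D : Set (Site 2) := {v | ‖triEmbed v‖ ≤ R} with hD
  set C : Set (Site 2) := {v | PathIn triGraph (D ∩ ω) x v} with hC
  have hCsub : ∀ {v}, v ∈ C → v ∈ D ∧ v ∈ ω := fun hv ↦ hv.right_mem
  have hCD : ∀ {v}, v ∈ C → ‖triEmbed v‖ ≤ R := fun hv ↦ (hCsub hv).1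
  have hxC : x ∈ C := PathIn.refl hxa.left_mem
  have haC : a ∈ C := hxa
  have hCpath : ∀ {v}, v ∈ C → PathIn triGraph C x v := by
    intro v hv
    obtain ⟨hx0, hrel⟩ := hv
    refine ⟨hxC, ?_⟩
    induction hrel with
    | refl => exact Relation.ReflTransGen.refl
    | @tail p q hp hq ih => exact ih.tail ⟨hq.1, show PathIn triGraph (D ∩ ω) x q from ⟨hx0, hp.tail hq⟩⟩
  have hCadj : ∀ {u v}, u ∈ C → triGraph.Adj u v → v ∈ D → v ∈ ω → v ∈ C :=
    fun hu huv hvD hvω ↦ PathIn.tail hu huv ⟨hvD, hvω⟩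
  have hbC : b ∉ C := fun h ↦ (not_le.2 hbR) (hCD h)
  have hCfin : C.Finite :=
    (Finset.finite_toSet (box 2 ⌈2 * R⌉₊)).subset (subset_box_of_norm_le fun v hv => hCD hv)
  -- neighbours of the cluster: closed in the annulus, and in the half-plane
  have hCnb : ∀ {u v}, u ∈ C → triGraph.Adj u v → v ∉ C → v ∈ ω → triNorm (v - c) < m := by
    intro u v hu huv hvC hvω
    have hvD : v ∉ D := fun hvD ↦ hvC (hCadj hu huv hvD hvω)
    exact hexit u v hu huv hvω (not_le.1 hvD)
  have hnbH : ∀ {u v}, u ∈ C → triGraph.Adj u v → c 1 ≤ v 1 := fun hu huv ↦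
    hH _ (by linarith [norm_triEmbed_le_of_adj huv, hCD hu])
  -- the interface loop of `C` through the dart `a → b`
  obtain ⟨F₀, w, hw, hfaces⟩ := exists_isSiteInterfaceLoop_of_adj hCfin hab haC hbC
  have hlen : 0 < w.length := by have := hw.isCycle.three_le_length; omega
  have hlr : hw.lv 0 = a ∧ hw.rv 0 = b := by
    obtain ⟨h', hfaces', -, -⟩ := hw.dart_spec hlen
    exact eq_of_triEdgeFaces_eq h' hab (hfaces'.trans hfaces.symm)
  -- winding numbers of the interface polygon (mesh `1`)
  obtain ⟨ρ, hρ⟩ := exists_polyTrace_subset_closedBall hlen (1 : ℝ)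
  have hWfar : ∀ v : Site 2, ρ < ‖triEmbed v‖ → loopWind 1 w (triMeshPoint 1 v) = 0 := fun v hv ↦
    loopWind_triMeshPoint_eq_zero_of_lt_norm one_pos hlen hρ (by rwa [one_mul])
  -- `b` escapes along a horizontal ray outside the disc: winding number `0`
  have hWb : loopWind 1 w (triMeshPoint 1 b) = 0 := by
    obtain ⟨u, hu0, hmono, hgrow, -⟩ := exists_adj_ray b 0
    simp only [sub_zero] at hmono hgrow
    obtain ⟨J, hJ⟩ := exists_nat_gt ρ
    have hray : ∀ i : ℕ, i ≤ J → b + (i : ℤ) • u ∈ Cᶜ := fun i _ hC' ↦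
      absurd ((hmono i).trans (hCD hC')) (not_le.2 hbR)
    rw [hw.loopWind_eq_of_pathIn_compl one_pos subset_rfl (pathIn_ray hu0 J hray)]
    exact hWfar _ (hJ.trans_le (hgrow J))
  -- so `a`, and the whole cluster, have winding number `1`
  have hWa : loopWind 1 w (triMeshPoint 1 a) = 1 := by
    have hjump := hw.loopWind_leftPt_sub_loopWind_rightPt one_pos hlen
    rw [IsSiteInterfaceLoop.leftPt, IsSiteInterfaceLoop.rightPt, hlr.1, hlr.2, hWb] at hjump
    omega
  have hWC : ∀ {v}, v ∈ C → loopWind 1 w (triMeshPoint 1 v) = 1 := fun hv ↦ by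
    rw [← hWa, ← hw.loopWind_eq_of_pathIn one_pos subset_rfl (hCpath haC),
      hw.loopWind_eq_of_pathIn one_pos subset_rfl (hCpath hv)]
  -- a farthest site of the cluster from `c` and its outward neighbour
  obtain ⟨xs, hxsC, hxsmax⟩ := C.exists_max_image (fun v ↦ ‖triEmbed v - triEmbed c‖) hCfin ⟨x, hxC⟩
  obtain ⟨u, hu0, -, hgrow, hstrict⟩ := exists_adj_ray xs (triEmbed c)
  have hout : ∀ j : ℕ, 1 ≤ j → xs + (j : ℤ) • u ∉ C := fun j hj hjC ↦
    absurd (hstrict j hj) (not_lt.2 (hxsmax _ hjC))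
  set ys : Site 2 := xs + (1 : ℤ) • u with hys
  have hysC : ys ∉ C := hout 1 le_rfl
  have hxsys : triGraph.Adj xs ys := by
    have h1 := (triGraph_adj_shift_iff xs 0 u).2 hu0
    simp only [Site.shift_apply, zero_add] at h1
    rw [hys, one_smul, add_comm]
    exact h1
  have hfar_ys : ‖triEmbed x - triEmbed c‖ < ‖triEmbed ys - triEmbed c‖ :=
    (hxsmax x hxC).trans_lt (hstrict 1 le_rfl)
  -- `ys` escapes along the ray: winding number `0`
  have hWys : loopWind 1 w (triMeshPoint 1 ys) = 0 := by
    obtain ⟨J, hJ⟩ := exists_nat_gt (ρ + ‖triEmbed c‖)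
    have hshift : ∀ i : ℕ, ys + (i : ℤ) • u = xs + ((i + 1 : ℕ) : ℤ) • u := fun i ↦ by
      rw [hys]; push_cast; rw [add_smul, one_smul]; abel
    have hray : ∀ i : ℕ, i ≤ J → ys + (i : ℤ) • u ∈ Cᶜ := fun i _ ↦ by
      rw [hshift]; exact hout (i + 1) (by omega)
    rw [hw.loopWind_eq_of_pathIn_compl one_pos subset_rfl (pathIn_ray hu0 J hray)]
    apply hWfar
    have h1 : ((J + 1 : ℕ) : ℝ) ≤ ‖triEmbed (ys + (J : ℤ) • u) - triEmbed c‖ := by rw [hshift]; exact hgrow (J + 1)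
    have h2 := norm_sub_le (triEmbed (ys + (J : ℤ) • u)) (triEmbed c)
    push_cast at h1
    linarith
  -- hence the loop crosses the edge `xs ys`: a dart `i` with left site `xs` and right site `ys`
  have hcross : ∃ i < w.length, hw.lv i = xs ∧ hw.rv i = ys := by
    by_contra hno
    push Not at hno
    have := hw.loopWind_triMeshPoint_eq_of_adj one_pos (Or.inr hxsys) fun i hi ↦
      ⟨fun hh ↦ hno i hi hh.1.symm hh.2.symm, fun hh ↦ hysC (hh.2 ▸ hw.lv_mem hi)⟩
    rw [hWC hxsC, hWys] at this
    exact one_ne_zero this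
  obtain ⟨i, hi, hli, hri⟩ := hcross
  -- the chain of right sites from `b = rv 0` to `ys = rv i`
  set S : Set (Site 2) := {v | ∃ k ≤ i, v = hw.rv k} with hS
  have hchain : ∀ k ≤ i, PathIn triGraph S b (hw.rv k) := by
    intro k hk
    induction k with
    | zero => rw [hlr.2]; exact PathIn.refl ⟨0, Nat.zero_le _, hlr.2.symm⟩
    | succ k ih =>
      have hk' : k ≤ i := by omega
      refine (ih hk').trans (PathIn.of_eq_or_adj ⟨k, hk', rfl⟩ ⟨k + 1, hk, rfl⟩ ?_)
      rcases hw.rv_succ_eq_or_adj (i := k) (by omega) with h | h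
      · exact Or.inl h.symm
      · exact Or.inr h
  have hSprop : ∀ v ∈ S, (v ∈ ω → triNorm (v - c) < m) ∧ c 1 ≤ v 1 := by
    rintro v ⟨k, hk, rfl⟩
    have hkl : k < w.length := by omega
    exact ⟨fun hvω ↦ hCnb (hw.lv_mem hkl) (hw.adj_lv_rv hkl) (hw.rv_not_mem hkl) hvω,
      hnbH (hw.lv_mem hkl) (hw.adj_lv_rv hkl)⟩
  -- recentre at `c`
  set φ := triShiftIso (-c) with hφ
  have hφapp : ∀ z, φ z = z - c := fun z ↦ by simp [hφ, sub_eq_add_neg]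
  have himage : ∀ (T : Set (Site 2)) (z : Site 2), z ∈ φ '' T ↔ z + c ∈ T := by
    intro T z
    constructor
    · rintro ⟨z', hz', rfl⟩; rw [hφapp]; simpa using hz'
    · intro hz; exact ⟨z + c, hz, by rw [hφapp]; simp⟩
  have hmemω : ∀ z, z ∈ SiteConfig.relabel φ.toEquiv ω ↔ z + c ∈ ω := by
    intro z
    rw [SiteConfig.mem_relabel_iff]
    have : φ.toEquiv.symm z = z + c := by
      apply φ.toEquiv.injective
      rw [Equiv.apply_symm_apply]
      show z = φ (z + c)
      rw [hφapp]; simp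
    rw [this]
  -- hexagonal distances from `c`
  have hnorm_n : ∀ {v : Site 2}, (n : ℝ) < ‖triEmbed v - triEmbed c‖ → (n : ℤ) ≤ triNorm (v - c) := by
    intro v hv
    have h1 : ‖triEmbed (v - c)‖ ≤ (triNorm (v - c) : ℝ) := norm_triEmbed_le_triNorm (v - c)
    rw [triEmbed_sub] at h1
    have : (n : ℝ) < (triNorm (v - c) : ℝ) := hv.trans_le h1
    exact_mod_cast this.le
  have hxn : (n : ℤ) ≤ triNorm (x - c) := hnorm_n hx
  have hysn : (n : ℤ) ≤ triNorm (ys - c) := hnorm_n (hx.trans hfar_ys)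
  have ham : triNorm (a - c) ≤ m := by
    have := triNorm_le_triNorm_add_one_of_adj ((triGraph_adj_sub_iff c b a).2 hab.symm)
    omega
  have hbm' : triNorm (b - c) ≤ m := by omega
  -- the open arm
  have hopen : PathIn triGraph (φ '' (D ∩ ω)) (a - c) (x - c) := by
    have := pathIn_map_iso φ hxa.symm
    rwa [hφapp, hφapp] at this
  obtain ⟨x₀, y₀, hx₀, hy₀, hp₀⟩ := hopen.exists_arm_of_triNorm_le ham hxn hmn
  -- the closed arm
  have hclosed : PathIn triGraph (φ '' S) (b - c) (ys - c) := by
    have := pathIn_map_iso φ (hchain i le_rfl)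
    rwa [hφapp, hφapp, hri] at this
  obtain ⟨x₁, y₁, hx₁, hy₁, hp₁⟩ := hclosed.exists_arm_of_triNorm_le hbm' hysn hmn
  -- assemble the two confined arms
  set Ann : Set (Site 2) := {z | (m : ℤ) ≤ triNorm z ∧ triNorm z ≤ n} with hAnn
  refine mem_domArmEvent_of_pathIn (κ := ![true, false]) ![Ann ∩ φ '' (D ∩ ω), Ann ∩ φ '' S]
    ?_ ?_ ?_ ?_ ?_
  · -- disjoint: open versus closed sites of the translated configuration
    have hd : Disjoint (Ann ∩ φ '' (D ∩ ω)) (Ann ∩ φ '' S) := by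
      rw [Set.disjoint_left]
      rintro z ⟨hzA, hz0⟩ ⟨-, hz1⟩
      rw [himage] at hz0 hz1
      have := (hSprop _ hz1).1 hz0.2
      rw [add_sub_cancel_right] at this
      exact absurd hzA.1 (not_le.2 this)
    intro i j hij
    fin_cases i <;> fin_cases j
    · exact absurd rfl hij
    · exact hd
    · exact hd.symm
    · exact absurd rfl hij
  · -- colours
    intro i z hz
    fin_cases i
    · change z ∈ Ann ∩ φ '' (D ∩ ω) at hz
      obtain ⟨-, hzT⟩ := hz
      rw [himage] at hzT
      change z ∈ SiteConfig.relabel φ.toEquiv ω ↔ true = true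
      rw [hmemω]
      exact ⟨fun _ ↦ rfl, fun _ ↦ hzT.2⟩
    · change z ∈ Ann ∩ φ '' S at hz
      obtain ⟨hzA, hzT⟩ := hz
      rw [himage] at hzT
      change z ∈ SiteConfig.relabel φ.toEquiv ω ↔ false = true
      rw [hmemω]
      refine ⟨fun hzω ↦ ?_, fun h ↦ absurd h Bool.false_ne_true⟩
      have := (hSprop _ hzT).1 hzω
      rw [add_sub_cancel_right] at this
      exact absurd hzA.1 (not_le.2 this)
  · -- annulus
    intro i z hz
    fin_cases i
    · change z ∈ Ann ∩ φ '' (D ∩ ω) at hz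
      exact hz.1
    · change z ∈ Ann ∩ φ '' S at hz
      exact hz.1
  · -- half-plane
    intro i z hz
    fin_cases i
    · change z ∈ Ann ∩ φ '' (D ∩ ω) at hz
      obtain ⟨-, hzT⟩ := hz
      rw [himage] at hzT
      have h1 := hH (z + c) (by linarith [show ‖triEmbed (z + c)‖ ≤ R from hzT.1])
      simp only [mem_upperHalfPlane, Pi.add_apply] at h1 ⊢
      linarith
    · change z ∈ Ann ∩ φ '' S at hz
      obtain ⟨-, hzT⟩ := hz
      rw [himage] at hzT
      have h1 := (hSprop _ hzT).2
      simp only [mem_upperHalfPlane, Pi.add_apply] at h1 ⊢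
      linarith
  · -- the arms
    intro i
    fin_cases i
    · exact ⟨x₀, mem_triSphere_iff.2 hx₀, y₀, mem_triSphere_iff.2 hy₀, hp₀⟩
    · exact ⟨x₁, mem_triSphere_iff.2 hx₁, y₁, mem_triSphere_iff.2 hy₁, hp₁⟩

/-! ### The centre below the disc -/

/-- **A lattice centre below the disc.** For `R ≥ 0` there is a site `c` on the imaginary axis,
within `7/2` of the bottom point `-iR` of the circle of radius `R` (indeed `c = -i√3 J`,
`J = ⌊R/√3⌋ + 2`, between `√3` and `2√3` below it), such that every site of norm `≤ R + 1` lies in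
the lattice half-plane `{v | c₁ ≤ v₁}` through `c` (the tangent at `-i` has the lattice direction
`e₀`). [folklore] -/
theorem exists_lsw_centre {R : ℝ} (hR : 0 ≤ R) :
    ∃ c : Site 2, ‖triEmbed c + (R : ℂ) * I‖ ≤ 7 / 2 ∧ ∀ v : Site 2, ‖triEmbed v‖ ≤ R + 1 → c 1 ≤ v 1 := by
  have hsq : (0 : ℝ) < Real.sqrt 3 := Real.sqrt_pos.2 (by norm_num)
  have hsq3 : Real.sqrt 3 * Real.sqrt 3 = 3 := Real.mul_self_sqrt (by norm_num)
  have hs74 : Real.sqrt 3 ≤ 7 / 4 := by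
    rw [Real.sqrt_le_left (by norm_num)]; norm_num
  have hs1 : (1 : ℝ) ≤ Real.sqrt 3 := Real.one_le_sqrt.2 (by norm_num)
  set J : ℕ := ⌊R / Real.sqrt 3⌋₊ + 2 with hJ
  have hJ1 : (⌊R / Real.sqrt 3⌋₊ : ℝ) ≤ R / Real.sqrt 3 := Nat.floor_le (div_nonneg hR hsq.le)
  have hJ2 : R / Real.sqrt 3 < (⌊R / Real.sqrt 3⌋₊ : ℝ) + 1 := Nat.lt_floor_add_one _
  have hJR : (J : ℝ) = (⌊R / Real.sqrt 3⌋₊ : ℝ) + 2 := by rw [hJ]; push_cast; ring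
  have hdiv : R / Real.sqrt 3 * Real.sqrt 3 = R := div_mul_cancel₀ R hsq.ne'
  -- `R + √3 ≤ √3 J ≤ R + 2√3`
  have hlo : R + Real.sqrt 3 ≤ Real.sqrt 3 * J := by rw [hJR]; nlinarith
  have hhi : Real.sqrt 3 * J ≤ R + 2 * Real.sqrt 3 := by rw [hJR]; nlinarith
  refine ⟨![(J : ℤ), -2 * (J : ℤ)], ?_, ?_⟩
  · have hval : triEmbed ![(J : ℤ), -2 * (J : ℤ)] + (R : ℂ) * I = ((R - Real.sqrt 3 * J : ℝ) : ℂ) * I := by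
      apply Complex.ext
      · simp [triEmbed_re]; ring
      · simp [triEmbed_im]; ring
    rw [hval, norm_mul, Complex.norm_I, mul_one, Complex.norm_real, Real.norm_eq_abs, abs_le]
    constructor <;> nlinarith
  · intro v hv
    have him : -(R + 1) ≤ (v 1 : ℝ) * (Real.sqrt 3 / 2) := by
      rw [← triEmbed_im]
      have := abs_im_le_norm (triEmbed v)
      rw [abs_le] at this
      linarith [this.1]
    have h1 : ((-2 * (J : ℤ) : ℤ) : ℝ) ≤ (v 1 : ℝ) := by
      push_cast
      rw [hJR]
      -- `-2 ⌊R/√3⌋ - 4 ≤ -2R/√3 - 2 ≤ -2(R+1)/√3 ≤ v₁`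
      have h2 : -(R + 1) * 2 ≤ (v 1 : ℝ) * Real.sqrt 3 := by nlinarith
      nlinarith
    have h3 : (![(J : ℤ), -2 * (J : ℤ)] : Site 2) 1 = -2 * (J : ℤ) := by simp
    rw [h3]
    exact_mod_cast h1

/-! ### From the hull event to the two arms -/

/-- **The hull event gives the two arms.** Let `R > 0`, `2π - θ ≤ r`, `c` a site within `7/2` of
`-iR` with all sites of norm `≤ R + 1` in `{v | c₁ ≤ v₁}`, and integers
`m ≥ (6/5)((2π - θ)(R + 1) + 5)`, `n ≤ rR - 7/2`, `m ≤ n`. If `Q_δ(2π) ⊄ Q_δ(θ) ∪ B̄(-i, r)`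
(`δ = 1/R`), then the configuration translated by `-c` has an open and a closed arm from `∂Λ_m` to
`∂Λ_n` in the upper half-plane. Indeed the bad point of `Q_δ(2π)` is not on the circle (the circle
minus the arc is within `2π - θ ≤ r` of `-i`), so it is `x/R` for a site `x` of a cluster of the disc
reaching the outside, `‖x - c‖ > rR - 7/2 ≥ n`, none of whose exits points in an arc direction:
an exit `b'` has `‖b' - |b'|(-i)‖ ≤ (2π - θ)|b'|`, `R < |b'| ≤ R + 1`, so
`|b' - c|_𝕋 ≤ (2/√3)‖b' - c‖ ≤ (6/5)((2π - θ)(R + 1) + 9/2) < m`; now apply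
`relabel_mem_domArmEvent_of_cluster`. [cite: LawlerSchrammWernerEJP2002, proof of Lemma 2.3, (2.13)–(2.14) (p. 6)] -/
theorem relabel_mem_domArmEvent_of_not_subset {R θ r : ℝ} (hR : 0 < R) (hεr : 2 * Real.pi - θ ≤ r)
    {c : Site 2} (hc : ‖triEmbed c + (R : ℂ) * I‖ ≤ 7 / 2)
    (hH : ∀ v : Site 2, ‖triEmbed v‖ ≤ R + 1 → c 1 ≤ v 1)
    {m n : ℕ} (hm : 6 / 5 * ((2 * Real.pi - θ) * (R + 1) + 5) ≤ m) (hn : (n : ℝ) + 7 / 2 ≤ r * R)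
    (hmn : m ≤ n) {ω : SiteConfig (Site 2)}
    (hω : ¬ (lswSet R ω ⊆ lswArcSet R θ ω ∪ closedBall (-I) r)) :
    SiteConfig.relabel (triShiftIso (-c)).toEquiv ω ∈ domArmEvent ![true, false] m n upperHalfPlane := by
  -- for `θ ≥ 2π` the arc hull is the whole hull
  rcases le_or_gt (2 * Real.pi) θ with hθ | hθ
  · exact absurd (fun p hp ↦ Or.inl (by rwa [lswArcSet_eq_lswSet hθ])) hω
  have hε : 0 < 2 * Real.pi - θ := by linarith
  rw [Set.not_subset] at hω
  obtain ⟨p, hp, hpnot⟩ := hω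
  rw [Set.mem_union, not_or] at hpnot
  obtain ⟨hpArc, hpBall⟩ := hpnot
  rcases hp with hp | ⟨x, hx, rfl⟩
  · -- a point of the circle off the arc is within `2π - θ ≤ r` of `-i`
    refine absurd ?_ hpBall
    rw [mem_closedBall, dist_eq_norm]
    exact (norm_sub_neg_I_le_of_mem_sphere_diff ⟨hp, fun h ↦ hpArc (Or.inl h)⟩).trans hεr
  · -- a site of a cluster of the disc with an exit, but no exit towards the arc
    obtain ⟨hxR, y, hy, hpath⟩ := hx
    have hxArc : x ∉ lswArcSites R θ ω := fun h ↦ hpArc (Or.inr ⟨x, h, rfl⟩)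
    obtain ⟨a, b, -, hb, hbω, hab, hpa⟩ :=
      hpath.exit (R := {v : Site 2 | ‖triEmbed v‖ ≤ R}) (show ‖triEmbed x‖ ≤ R from hxR.le)
        (show ¬ (‖triEmbed y‖ ≤ R) from not_le.2 hy)
    have hbR : R < ‖triEmbed b‖ := not_le.1 hb
    -- `2/√3 ≤ 6/5`
    have hsq : (5 : ℝ) / 3 ≤ Real.sqrt 3 := by
      have h53 : Real.sqrt ((5 / 3 : ℝ) ^ 2) = 5 / 3 := Real.sqrt_sq (by norm_num)
      rw [← h53]
      exact Real.sqrt_le_sqrt (by norm_num)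
    -- every exit is near `c`
    have hexit : ∀ a' b' : Site 2, PathIn triGraph ({v : Site 2 | ‖triEmbed v‖ ≤ R} ∩ ω) x a' →
        triGraph.Adj a' b' → b' ∈ ω → R < ‖triEmbed b'‖ → triNorm (b' - c) < m := by
      intro a' b' hpa' hab' hb'ω hb'R
      have hdir : ¬ InBottomArcDir θ (triEmbed b') := fun hdir ↦
        hxArc ⟨hxR, a', b', hpa', hab', hb'ω, hb'R, hdir⟩
      have h1 := norm_sub_norm_mul_neg_I_le_of_not_inBottomArcDir hdir
      have hb'le : ‖triEmbed b'‖ ≤ R + 1 := by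
        linarith [norm_triEmbed_le_of_adj hab', show ‖triEmbed a'‖ ≤ R from hpa'.right_mem.1]
      have h2 : ‖triEmbed b' - triEmbed c‖ ≤ (2 * Real.pi - θ) * (R + 1) + 9 / 2 := by
        have e : triEmbed b' - triEmbed c = (triEmbed b' - (‖triEmbed b'‖ : ℂ) * (-I)) +
            (((‖triEmbed b'‖ - R : ℝ) : ℂ) * (-I)) - (triEmbed c + (R : ℂ) * I) := by push_cast; ring
        have n2 : ‖((‖triEmbed b'‖ - R : ℝ) : ℂ) * (-I)‖ ≤ 1 := by
          rw [norm_mul, norm_neg, Complex.norm_I, mul_one, Complex.norm_real, Real.norm_eq_abs, abs_le]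
          constructor <;> linarith
        have n1 : (2 * Real.pi - θ) * ‖triEmbed b'‖ ≤ (2 * Real.pi - θ) * (R + 1) :=
          mul_le_mul_of_nonneg_left hb'le hε.le
        rw [e]
        calc ‖triEmbed b' - (‖triEmbed b'‖ : ℂ) * (-I) + ((‖triEmbed b'‖ - R : ℝ) : ℂ) * (-I) -
              (triEmbed c + (R : ℂ) * I)‖
            ≤ ‖triEmbed b' - (‖triEmbed b'‖ : ℂ) * (-I) + ((‖triEmbed b'‖ - R : ℝ) : ℂ) * (-I)‖ +
              ‖triEmbed c + (R : ℂ) * I‖ := norm_sub_le _ _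
          _ ≤ ‖triEmbed b' - (‖triEmbed b'‖ : ℂ) * (-I)‖ + ‖((‖triEmbed b'‖ - R : ℝ) : ℂ) * (-I)‖ +
              ‖triEmbed c + (R : ℂ) * I‖ := by gcongr; exact norm_add_le _ _
          _ ≤ (2 * Real.pi - θ) * (R + 1) + 1 + 7 / 2 := by linarith
          _ = (2 * Real.pi - θ) * (R + 1) + 9 / 2 := by ring
      have h3 := mul_triNorm_le_norm_triEmbed (b' - c)
      rw [triEmbed_sub] at h3
      have h4 : (0 : ℝ) ≤ triNorm (b' - c) := by exact_mod_cast triNorm_nonneg (b' - c)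
      have h5 : (triNorm (b' - c) : ℝ) < m := by nlinarith
      exact_mod_cast h5
    have hbm : triNorm (b - c) < m := hexit a b hpa hab hbω hbR
    -- `x` is far from `c`
    have hx : (n : ℝ) < ‖triEmbed x - triEmbed c‖ := by
      rw [mem_closedBall, not_le, dist_eq_norm] at hpBall
      have e1 : triMeshPoint R⁻¹ x - (-I) = ((R⁻¹ : ℝ) : ℂ) * (triEmbed x + (R : ℂ) * I) := by
        have hR' : (R : ℂ) ≠ 0 := by exact_mod_cast hR.ne'
        simp only [triMeshPoint, sub_neg_eq_add, mul_add]
        push_cast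
        rw [← mul_assoc, inv_mul_cancel₀ hR', one_mul]
      rw [e1, norm_mul, Complex.norm_real, Real.norm_of_nonneg (inv_nonneg.2 hR.le)] at hpBall
      have h4 : r * R < ‖triEmbed x + (R : ℂ) * I‖ := by
        calc r * R < R⁻¹ * ‖triEmbed x + (R : ℂ) * I‖ * R := mul_lt_mul_of_pos_right hpBall hR
          _ = ‖triEmbed x + (R : ℂ) * I‖ := by rw [inv_mul_eq_div, div_mul_cancel₀ _ hR.ne']
      have h5 : ‖triEmbed x + (R : ℂ) * I‖ ≤ ‖triEmbed x - triEmbed c‖ + ‖triEmbed c + (R : ℂ) * I‖ := by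
        have := norm_add_le (triEmbed x - triEmbed c) (triEmbed c + (R : ℂ) * I)
        rwa [show triEmbed x - triEmbed c + (triEmbed c + (R : ℂ) * I) = triEmbed x + (R : ℂ) * I by ring] at this
      linarith
    exact relabel_mem_domArmEvent_of_cluster hpa hab hbR hexit hbm hx hmn hH

/-! ### The tail bound -/

/-- **The tail at a fixed mesh.** Under the hypotheses of `relabel_mem_domArmEvent_of_not_subset`,
and given the half-plane two-arm bound `P(domArmEvent κ m n upperHalfPlane) ≤ C m/n` for
`n₀ ≤ m ≤ n` (`Nolin2008_halfPlane_twoArm_holds`) with `n₀ ≤ m`: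
`P[Q_δ(2π) ⊄ Q_δ(θ) ∪ B̄(-i, r)] ≤ C m/n` (translation invariance of `P_{1/2}`).
[cite: LawlerSchrammWernerEJP2002, proof of Lemma 2.3, (2.13)–(2.14) (p. 6)] [cite: Nolin2008, Thm. 24 (i)] -/
theorem lswPairLaw_real_not_subset_le {R θ r : ℝ} (hR : 0 < R) (hεr : 2 * Real.pi - θ ≤ r)
    {c : Site 2} (hc : ‖triEmbed c + (R : ℂ) * I‖ ≤ 7 / 2)
    (hH : ∀ v : Site 2, ‖triEmbed v‖ ≤ R + 1 → c 1 ≤ v 1)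
    {m n : ℕ} (hm : 6 / 5 * ((2 * Real.pi - θ) * (R + 1) + 5) ≤ m) (hn : (n : ℝ) + 7 / 2 ≤ r * R)
    (hmn : m ≤ n) {n₀ : ℕ} {C : ℝ}
    (hN : ∀ κ : Fin 2 → Bool, ∀ m n : ℕ, n₀ ≤ m → m ≤ n →
      (triSitePercolation half).real (domArmEvent κ m n upperHalfPlane) ≤ C * ((m : ℝ) / n))
    (hn₀ : n₀ ≤ m) :
    (lswPairLaw R θ : Measure (NonemptyCompacts ℂ × NonemptyCompacts ℂ)).real
        {p | ¬ (((p.2 : NonemptyCompacts ℂ) : Set ℂ) ⊆ (p.1 : Set ℂ) ∪ closedBall (-I) r)} ≤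
      C * ((m : ℝ) / n) := by
  set T : Set (NonemptyCompacts ℂ × NonemptyCompacts ℂ) :=
    {p | ¬ (((p.2 : NonemptyCompacts ℂ) : Set ℂ) ⊆ (p.1 : Set ℂ) ∪ closedBall (-I) r)} with hT
  have hTm : MeasurableSet T :=
    (isClosed_setOf_snd_subset_fst_union (C := closedBall (-I) r) isClosed_closedBall).measurableSet.compl
  have hsub : lswArcPair R θ ⁻¹' T ⊆
      SiteConfig.relabel (triShiftIso (-c)).toEquiv ⁻¹' domArmEvent ![true, false] m n upperHalfPlane :=
    fun ω hω ↦ relabel_mem_domArmEvent_of_not_subset hR hεr hc hH hm hn hmn hω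
  rw [measureReal_def, lswPairLaw_apply R θ hTm, ← measureReal_def]
  calc (triSitePercolation half).real (lswArcPair R θ ⁻¹' T)
      ≤ (triSitePercolation half).real
          (SiteConfig.relabel (triShiftIso (-c)).toEquiv ⁻¹' domArmEvent ![true, false] m n upperHalfPlane) :=
        measureReal_mono hsub
    _ = (triSitePercolation half).real (domArmEvent ![true, false] m n upperHalfPlane) :=
        sitePercolation_real_preimage_relabel (triShiftIso (-c)).toEquiv half _
    _ ≤ C * ((m : ℝ) / n) := hN _ m n hn₀ hmn

/-- **The tail estimate (2.14) for the discrete arc hulls, with the two-arm exponent `1`.** There is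
`c > 0` such that for every `θ < 2π` and `r > 0`, eventually as `R → ∞`:
`P[Q_δ(2π) ⊄ Q_δ(θ) ∪ B̄(-i, r)] ≤ c (2π - θ)/r` (`δ = 1/R`; the joint law `lswPairLaw R θ`).
For `r ≤ 4(2π - θ)` the bound is trivial; otherwise take `m = ⌈(6/5)((2π - θ)(R + 1) + 5)⌉ ≍ (2π - θ) R`
and `n = ⌊rR - 7/2⌋ ≍ rR` in `lswPairLaw_real_not_subset_le`. LSW's (2.14) has `(ε/r)^{1+α}` from the
three-arm bound (2.13); the exponent `1` (Nolin's half-plane two-arm exponent) suffices for the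
identification of the trace (`OneArmNeumannCouplingLinear.lean`).
[cite: LawlerSchrammWernerEJP2002, proof of Lemma 2.3, (2.13)–(2.14) (p. 6)] [cite: Nolin2008, Thm. 24 (i)] -/
theorem lswPairLaw_real_not_subset_eventually_le :
    ∃ c : ℝ, 0 < c ∧ ∀ θ r : ℝ, θ < 2 * Real.pi → 0 < r → ∀ᶠ R : ℝ in atTop,
      (lswPairLaw R θ : Measure (NonemptyCompacts ℂ × NonemptyCompacts ℂ)).real
          {p | ¬ (((p.2 : NonemptyCompacts ℂ) : Set ℂ) ⊆ (p.1 : Set ℂ) ∪ closedBall (-I) r)} ≤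
        c * ((2 * Real.pi - θ) / r) := by
  obtain ⟨n₀, C, hN⟩ := Nolin2008_halfPlane_twoArm_holds
  set C' : ℝ := max C 0 with hC'
  have hC'0 : 0 ≤ C' := le_max_right _ _
  have hN' : ∀ κ : Fin 2 → Bool, ∀ m n : ℕ, n₀ ≤ m → m ≤ n →
      (triSitePercolation half).real (domArmEvent κ m n upperHalfPlane) ≤ C' * ((m : ℝ) / n) :=
    fun κ m n h1 h2 ↦ (hN κ m n h1 h2).trans (mul_le_mul_of_nonneg_right (le_max_left _ _) (by positivity))
  refine ⟨max (4 * C') 4, lt_max_of_lt_right (by norm_num), fun θ r hθ hr ↦ ?_⟩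
  set ε : ℝ := 2 * Real.pi - θ with hεdef
  have hε : 0 < ε := by rw [hεdef]; linarith
  have hc4 : (4 : ℝ) ≤ max (4 * C') 4 := le_max_right _ _
  by_cases hcase : r ≤ 4 * ε
  · -- trivial bound
    refine Eventually.of_forall fun R ↦ ?_
    have h1 : (1 : ℝ) ≤ 4 * (ε / r) := by
      rw [mul_div_assoc', le_div_iff₀ hr]; linarith
    calc (lswPairLaw R θ : Measure (NonemptyCompacts ℂ × NonemptyCompacts ℂ)).real _ ≤ 1 := measureReal_le_one
      _ ≤ 4 * (ε / r) := h1
      _ ≤ max (4 * C') 4 * (ε / r) := mul_le_mul_of_nonneg_right hc4 (by positivity)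
  · push Not at hcase
    filter_upwards [eventually_ge_atTop (1 : ℝ), eventually_ge_atTop (3 / 2 + 10 / ε),
      eventually_ge_atTop ((n₀ : ℝ) / ε), eventually_ge_atTop (10 / r)] with R hR1 hR2 hR3 hR4
    have hR0 : 0 < R := by linarith
    obtain ⟨c₀, hc₀, hH⟩ := exists_lsw_centre hR0.le
    set m : ℕ := ⌈6 / 5 * (ε * (R + 1) + 5)⌉₊ with hmdef
    set n : ℕ := ⌊r * R - 7 / 2⌋₊ with hndef
    have hεR : (n₀ : ℝ) ≤ ε * R := by rwa [div_le_iff₀ hε, mul_comm] at hR3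
    have hrR : 10 ≤ r * R := by rwa [div_le_iff₀ hr, mul_comm] at hR4
    have hm1 : 6 / 5 * (ε * (R + 1) + 5) ≤ m := Nat.le_ceil _
    have hm2 : (m : ℝ) < 6 / 5 * (ε * (R + 1) + 5) + 1 := Nat.ceil_lt_add_one (by positivity)
    have hm3 : (m : ℝ) ≤ 2 * ε * R := by
      have : 6 / 5 * ε + 7 ≤ 4 / 5 * ε * R := by
        have h := mul_le_mul_of_nonneg_left hR2 (show (0 : ℝ) ≤ 4 / 5 * ε by positivity)
        rw [mul_add, show 4 / 5 * ε * (10 / ε) = 8 by field_simp; ring] at h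
        linarith
      linarith
    have hn1 : (n : ℝ) ≤ r * R - 7 / 2 := Nat.floor_le (by linarith)
    have hn2 : r * R - 7 / 2 < n + 1 := Nat.lt_floor_add_one _
    have hn3 : r * R / 2 ≤ n := by linarith
    have hnpos : (0 : ℝ) < n := by linarith
    have hmn_real : (m : ℝ) ≤ n := by nlinarith
    have hmn : m ≤ n := by exact_mod_cast hmn_real
    have hn₀m : n₀ ≤ m := by
      have : (n₀ : ℝ) ≤ m := by nlinarith
      exact_mod_cast this
    have hεr : 2 * Real.pi - θ ≤ r := by rw [← hεdef]; linarith
    have hbound := lswPairLaw_real_not_subset_le hR0 hεr hc₀ hH hm1 (by linarith) hmn hN' hn₀m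
    have hratio : (m : ℝ) / n ≤ 4 * (ε / r) := by
      rw [div_le_iff₀ hnpos, mul_div_assoc', div_mul_eq_mul_div, le_div_iff₀ hr]
      nlinarith
    calc (lswPairLaw R θ : Measure (NonemptyCompacts ℂ × NonemptyCompacts ℂ)).real _ ≤ C' * ((m : ℝ) / n) := hbound
      _ ≤ C' * (4 * (ε / r)) := mul_le_mul_of_nonneg_left hratio hC'0
      _ = 4 * C' * (ε / r) := by ring
      _ ≤ max (4 * C') 4 * (ε / r) := mul_le_mul_of_nonneg_right (le_max_left _ _) (by positivity)

end Literature.Probability.Percolation
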